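import Summits.KontsevichZagierPeriods.KontsevichZagierPeriods.Theorems.LinRedNormalFormArrangementNormalFormSeparateTwoOrder

/-!
# Rigidity, direction selection and elementary power bounds

(Line `janus-bands`, crux `ArrangementNormalForm`, stub `stub_separateTwoZero` — separation in a
good rational direction for PLANAR arrangement representations without fibres; part `Aux`.)

Auxiliaries of the power counting: a real polynomial function vanishing on an interval has zero
coefficients (`coeff_eq_zero_of_eqOn_Ioo`, registered as `separateTwoZero_aux`); a non-trivial
one is non-zero on a closed sub-interval of any interval (`exists_Icc_poly_ne_zero`: the good
slopes); the dictionary with the double sums of part `SeparateTwoOrder` (`dsum_product`,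
`dpart_smul`, `dpart_one_eq`); the order bound `|qᵢ(u)| ≤ C|u|^{D ∸ i}` (`abs_coeff_le`); and
the inequalities `|u|^a |λ|^i/|λ|^n ≤ K r^D/r^n` of the upper power bound.
-/

noncomputable section

open Set MeasureTheory Filter Topology
open scoped ENNReal

namespace Summit.KontsevichZagierPeriods.ArrangementNormalForm.JanusBands

namespace SepTwoZero

/-- **Rigidity**: a real polynomial function vanishing on an open interval has zero coefficients. -/
theorem coeff_eq_zero_of_eqOn_Ioo (c : ℕ → ℝ) (N : ℕ) {a b : ℝ} (hab : a < b)
    (h : ∀ t ∈ Ioo a b, ∑ m ∈ Finset.range N, c m * t ^ m = 0) : ∀ m < N, c m = 0 := by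
  set P : Polynomial ℝ := ∑ m ∈ Finset.range N, Polynomial.C (c m) * Polynomial.X ^ m with hP
  have heval : ∀ t, P.eval t = ∑ m ∈ Finset.range N, c m * t ^ m := fun t => by
    simp [hP, Polynomial.eval_finsetSum]
  have hroots : {x | P.IsRoot x}.Infinite :=
    (Ioo_infinite hab).mono fun t ht => by simp [Polynomial.IsRoot, heval, h t ht]
  have hP0 : P = 0 := Polynomial.eq_zero_of_infinite_isRoot P hroots
  intro m hm
  have hc : P.coeff m = c m := by
    simp only [hP, Polynomial.finsetSum_coeff, Polynomial.coeff_C_mul, Polynomial.coeff_X_pow,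
      mul_ite, mul_one, mul_zero]
    rw [Finset.sum_ite_eq (Finset.range N) m (fun x => c x)]
    simp [hm]
  rw [← hc, hP0, Polynomial.coeff_zero]

/-- A polynomial function vanishing on an open interval vanishes identically. -/
theorem poly_eq_zero_of_eqOn_Ioo (c : ℕ → ℝ) (N : ℕ) {a b : ℝ} (hab : a < b)
    (h : ∀ t ∈ Ioo a b, ∑ m ∈ Finset.range N, c m * t ^ m = 0) (t : ℝ) :
    ∑ m ∈ Finset.range N, c m * t ^ m = 0 :=
  Finset.sum_eq_zero fun m hm => by
    rw [coeff_eq_zero_of_eqOn_Ioo c N hab h m (Finset.mem_range.1 hm), zero_mul]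

/-- **Direction selection**: a polynomial function with a nonzero coefficient is nonzero on a
closed subinterval of any open interval. -/
theorem exists_Icc_poly_ne_zero (e : ℕ → ℝ) (K : ℕ) (hk : ∃ k < K, e k ≠ 0) {m₁ m₂ : ℝ}
    (hm : m₁ < m₂) : ∃ a b, m₁ < a ∧ a < b ∧ b < m₂ ∧
      ∀ m ∈ Icc a b, ∑ k ∈ Finset.range K, e k * m ^ k ≠ 0 := by
  obtain ⟨k, hkK, hek⟩ := hk
  have hex : ∃ ms ∈ Ioo m₁ m₂, ∑ k ∈ Finset.range K, e k * ms ^ k ≠ 0 := by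
    by_contra hall
    push Not at hall
    exact hek (coeff_eq_zero_of_eqOn_Ioo e K hm hall k hkK)
  obtain ⟨ms, hms, hne⟩ := hex
  have hcont : Continuous fun m : ℝ => ∑ k ∈ Finset.range K, e k * m ^ k := by fun_prop
  have hev : ∀ᶠ m in 𝓝 ms, ∑ k ∈ Finset.range K, e k * m ^ k ≠ 0 :=
    (hcont.tendsto ms).eventually_ne hne
  obtain ⟨ε, hε, hεb⟩ := Metric.eventually_nhds_iff.1 hev
  set ε' := min (ε / 2) (min ((ms - m₁) / 2) ((m₂ - ms) / 2)) with hε'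
  have hε'pos : 0 < ε' := by
    rw [hε']; refine lt_min (by linarith) (lt_min (by linarith [hms.1]) (by linarith [hms.2]))
  have h1 : ε' ≤ ε / 2 := min_le_left _ _
  have h2 : ε' ≤ (ms - m₁) / 2 := (min_le_right _ _).trans (min_le_left _ _)
  have h3 : ε' ≤ (m₂ - ms) / 2 := (min_le_right _ _).trans (min_le_right _ _)
  refine ⟨ms - ε', ms + ε', by linarith, by linarith, by linarith, fun m hm' => hεb ?_⟩
  rw [Real.dist_eq, abs_lt]
  constructor <;> linarith [hm'.1, hm'.2]

/-- The double sum over a product index set, grouped by powers of `λ`. -/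
theorem dsum_product (N N' : ℕ) (c : ℕ × ℕ → ℝ) (u l : ℝ) :
    SepTwo.dsum (Finset.range N ×ˢ Finset.range N') c u l =
      ∑ i ∈ Finset.range N, (∑ m ∈ Finset.range N', c (i, m) * u ^ m) * l ^ i := by
  unfold SepTwo.dsum
  rw [Finset.sum_product]
  refine Finset.sum_congr rfl fun i _ => ?_
  rw [Finset.sum_mul]

/-- Homogeneity of the degree-`d` part. -/
theorem dpart_smul (T : Finset (ℕ × ℕ)) (c : ℕ × ℕ → ℝ) (d : ℕ) (t u l : ℝ) :
    SepTwo.dpart T c d (t * u) (t * l) = t ^ d * SepTwo.dpart T c d u l := by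
  unfold SepTwo.dpart
  rw [Finset.mul_sum]
  refine Finset.sum_congr rfl fun im him => ?_
  have he : im.1 + im.2 = d := (Finset.mem_filter.1 him).2
  rw [mul_pow, mul_pow, ← he, pow_add]
  ring

/-- The degree-`d` part along the directions `(1, m)` is an explicit polynomial in `m`. -/
theorem dpart_one_eq (T : Finset (ℕ × ℕ)) (c : ℕ × ℕ → ℝ) (d : ℕ) (m : ℝ) :
    SepTwo.dpart T c d 1 m =
      ∑ k ∈ Finset.range (d + 1), (if (k, d - k) ∈ T then c (k, d - k) else 0) * m ^ k := by
  classical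
  unfold SepTwo.dpart
  have hR : ∑ k ∈ Finset.range (d + 1), (if (k, d - k) ∈ T then c (k, d - k) else 0) * m ^ k =
      ∑ k ∈ (Finset.range (d + 1)).filter (fun k => (k, d - k) ∈ T), c (k, d - k) * m ^ k := by
    rw [Finset.sum_filter]
    exact Finset.sum_congr rfl fun k _ => by split_ifs <;> simp
  rw [hR]
  refine Finset.sum_bij' (fun im _ => im.1) (fun k _ => (k, d - k)) ?_ ?_ ?_ ?_ ?_
  · intro im him
    obtain ⟨hT, he⟩ := Finset.mem_filter.1 him
    refine Finset.mem_filter.2 ⟨Finset.mem_range.2 (by omega), ?_⟩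
    have : (im.1, d - im.1) = im := Prod.ext rfl (by simp; omega)
    rwa [this]
  · intro k hk
    obtain ⟨hk1, hk2⟩ := Finset.mem_filter.1 hk
    exact Finset.mem_filter.2 ⟨hk2, by simp; have := Finset.mem_range.1 hk1; omega⟩
  · intro im him
    obtain ⟨-, he⟩ := Finset.mem_filter.1 him
    exact Prod.ext rfl (by simp; omega)
  · intro k _; rfl
  · intro im him
    obtain ⟨-, he⟩ := Finset.mem_filter.1 him
    have : (im.1, d - im.1) = im := Prod.ext rfl (by simp; omega)
    rw [this, one_pow, mul_one]

/-- **Order bound for the Taylor coefficients**: `|qᵢ(u)| ≤ C |u|^{D ∸ i}` on `|u| ≤ 1`. -/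
theorem abs_coeff_le {N N' D : ℕ} (c : ℕ × ℕ → ℝ)
    (hd : ∀ im ∈ Finset.range N ×ˢ Finset.range N', c im ≠ 0 → D ≤ im.1 + im.2)
    {i : ℕ} (hi : i < N) {u : ℝ} (hu : |u| ≤ 1) :
    |∑ m ∈ Finset.range N', c (i, m) * u ^ m| ≤
      (∑ im ∈ Finset.range N ×ˢ Finset.range N', |c im|) * |u| ^ (D - i) := by
  calc |∑ m ∈ Finset.range N', c (i, m) * u ^ m|
      ≤ ∑ m ∈ Finset.range N', |c (i, m) * u ^ m| := Finset.abs_sum_le_sum_abs _ _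
    _ ≤ ∑ m ∈ Finset.range N', |c (i, m)| * |u| ^ (D - i) := by
        refine Finset.sum_le_sum fun m hm => ?_
        rw [abs_mul, abs_pow]
        by_cases hc : c (i, m) = 0
        · simp [hc]
        · refine mul_le_mul_of_nonneg_left (pow_le_pow_of_le_one (abs_nonneg _) hu ?_)
            (abs_nonneg _)
          have := hd (i, m) (Finset.mem_product.2 ⟨Finset.mem_range.2 hi, hm⟩) hc
          simp at this; omega
    _ = (∑ im ∈ {i} ×ˢ Finset.range N', |c im|) * |u| ^ (D - i) := by
        rw [← Finset.sum_mul, Finset.sum_product, Finset.sum_singleton]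
    _ ≤ _ := by
        refine mul_le_mul_of_nonneg_right (Finset.sum_le_sum_of_subset_of_nonneg
          (Finset.product_subset_product_left ?_) fun _ _ _ => abs_nonneg _) (by positivity)
        exact Finset.singleton_subset_iff.2 (Finset.mem_range.2 hi)

/-- `r^{D ∸ n} ≤ r^D / r^n` for `0 < r ≤ 1`. -/
theorem pow_tsub_le_div {r : ℝ} (hr : 0 < r) (hr1 : r ≤ 1) (D n : ℕ) :
    r ^ (D - n) ≤ r ^ D / r ^ n := by
  rcases le_or_gt n D with h | h
  · rw [pow_sub₀ _ hr.ne' h, div_eq_mul_inv]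
  · rw [Nat.sub_eq_zero_of_le h.le, pow_zero, le_div_iff₀ (pow_pos hr _), one_mul]
    exact pow_le_pow_of_le_one hr.le hr1 h.le

/-- Power counting, regular case `n ≤ i`. -/
theorem pow_bound_of_le {r u l : ℝ} (hr : 0 < r) (hr1 : r ≤ 1) (hu : |u| ≤ r) (hl : |l| ≤ r)
    {a i n D : ℕ} (hni : n ≤ i) (haD : D ≤ a + i) :
    |u| ^ a * (|l| ^ i / |l| ^ n) ≤ r ^ D / r ^ n := by
  by_cases hl0 : l = 0 ∧ n ≠ 0
  · obtain ⟨rfl, hn⟩ := hl0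
    rw [abs_zero, zero_pow hn, div_zero, mul_zero]
    positivity
  · have hq : |l| ^ i / |l| ^ n = |l| ^ (i - n) := by
      rcases not_and_or.1 hl0 with h | h
      · rw [pow_sub₀ _ (abs_ne_zero.2 h) hni, div_eq_mul_inv]
      · push Not at h; rw [h, pow_zero, div_one, Nat.sub_zero]
    rw [hq]
    calc |u| ^ a * |l| ^ (i - n) ≤ r ^ a * r ^ (i - n) :=
          mul_le_mul (pow_le_pow_left₀ (abs_nonneg _) hu _) (pow_le_pow_left₀ (abs_nonneg _)
            hl _) (by positivity) (by positivity)
      _ = r ^ (a + (i - n)) := by rw [pow_add]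
      _ ≤ r ^ (D - n) := pow_le_pow_of_le_one hr.le hr1 (by omega)
      _ ≤ r ^ D / r ^ n := pow_tsub_le_div hr hr1 D n

/-- Power counting, transversal pole case `i < n` with `r ≤ K |λ|`. -/
theorem pow_bound_of_lt {r u l K : ℝ} (hr : 0 < r) (hr1 : r ≤ 1) (hu : |u| ≤ r)
    (hK : 1 ≤ K) (hrl : r ≤ K * |l|) {a i n D : ℕ} (hin : i < n) (haD : D ≤ a + i) :
    |u| ^ a * (|l| ^ i / |l| ^ n) ≤ K ^ n * (r ^ D / r ^ n) := by
  have hl0 : 0 < |l| := by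
    by_contra h; push Not at h
    have : |l| = 0 := le_antisymm h (abs_nonneg _)
    rw [this, mul_zero] at hrl; linarith
  have h1 : |l| ^ i / |l| ^ n = 1 / |l| ^ (n - i) := by
    rw [eq_div_iff (pow_ne_zero _ hl0.ne'), div_mul_eq_mul_div, ← pow_add,
      Nat.add_sub_cancel' hin.le, div_self (pow_ne_zero _ hl0.ne')]
  have h2 : 1 / |l| ≤ K / r := by
    rw [div_le_div_iff₀ hl0 hr, one_mul]; exact hrl
  have h3 : 1 / |l| ^ (n - i) ≤ K ^ n / r ^ (n - i) := by
    calc 1 / |l| ^ (n - i) = (1 / |l|) ^ (n - i) := by rw [one_div_pow]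
      _ ≤ (K / r) ^ (n - i) := pow_le_pow_left₀ (by positivity) h2 _
      _ = K ^ (n - i) / r ^ (n - i) := div_pow _ _ _
      _ ≤ K ^ n / r ^ (n - i) := by
          gcongr
          exact Nat.sub_le _ _
  rw [h1]
  calc |u| ^ a * (1 / |l| ^ (n - i)) ≤ r ^ a * (K ^ n / r ^ (n - i)) :=
        mul_le_mul (pow_le_pow_left₀ (abs_nonneg _) hu _) h3 (by positivity) (by positivity)
    _ = K ^ n * (r ^ a / r ^ (n - i)) := by ring
    _ ≤ K ^ n * (r ^ D / r ^ n) := by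
        refine mul_le_mul_of_nonneg_left ?_ (by positivity)
        rw [div_le_div_iff₀ (pow_pos hr _) (pow_pos hr _), ← pow_add, ← pow_add]
        exact pow_le_pow_of_le_one hr.le hr1 (by omega)

/-- Power counting for the walls through the vertex: `1/|u|^E ≤ K^E / r^E` if `r ≤ K |u|`. -/
theorem inv_pow_bound {r u K : ℝ} (hr : 0 < r) (hru : r ≤ K * |u|) (E : ℕ) :
    1 / |u| ^ E ≤ K ^ E / r ^ E := by
  have hK : 0 < K * |u| := hr.trans_le hru
  have hu0 : 0 < |u| := by
    rcases (abs_nonneg u).lt_or_eq with h | h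
    · exact h
    · rw [← h, mul_zero] at hK; exact absurd hK (lt_irrefl _)
  calc 1 / |u| ^ E = (1 / |u|) ^ E := by rw [one_div_pow]
    _ ≤ (K / r) ^ E := pow_le_pow_left₀ (by positivity) (by
        rw [div_le_div_iff₀ hu0 hr, one_mul]; exact hru) _
    _ = K ^ E / r ^ E := div_pow _ _ _

/-- The dominating weight: `r^D / r^{M} ≤ r⁻¹` for `0 < r ≤ 1`, `1 ≤ M ≤ D + 1`. -/
theorem div_pow_le_inv {r : ℝ} (hr : 0 < r) (hr1 : r ≤ 1) {D M : ℕ} (hM : M ≤ D + 1) :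
    r ^ D / r ^ M ≤ r⁻¹ := by
  rw [div_le_iff₀ (pow_pos hr _), ← div_eq_inv_mul, le_div_iff₀ hr, ← pow_succ]
  exact pow_le_pow_of_le_one hr.le hr1 hM

end SepTwoZero

open SepTwoZero in
/-- **Rigidity of real polynomial functions** (registered sub-goal of `stub_separateTwoZero`). -/
theorem separateTwoZero_aux (c : ℕ → ℝ) (N : ℕ) (a b : ℝ) (hab : a < b) (h : ∀ t ∈ Set.Ioo a b, ∑ m ∈ Finset.range N, c m * t ^ m = 0) (m : ℕ) (hm : m < N) : c m = 0 := by
  exact coeff_eq_zero_of_eqOn_Ioo c N hab h m hm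

end Summit.KontsevichZagierPeriods.ArrangementNormalForm.JanusBands
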